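import Summits.PneNP.PneNP.Theorems.SymmetryBudgetWindowCanoniserDagDefs
import Literature.Computability.AlgebraicComplexity.SymmetricThresholdTranslation

/-!
# Window canoniser, XI: gate semantics — generalities

Route `PneNP/SymmetryBudget`, dichotomy `WindowBarrier` (stmt-PneNP-2145) / `NoHiddenOrder` (stmt-PneNP-14781);
continuation of `…WindowCanoniserDagDefs.lean`.  The value `WCan.ev x a` of an atom on the input matrix `x` (the
values of `WCan.wDAG` do not depend on the output wire), the window graph `WCan.G x` and the outside bits
`WCan.xo x`, and how the generic gates read: negated atoms, literals, the padded width-8/width-4 formulas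
(`n1and`, `n1or`, `litN1`, `n2and`, `n2or`, `iffF`), padded majority COUNTERS (`WCan.maj_cnt_iff`:
`MAJ_{2N}` over `N` wires and `N - θ` true paddings fires iff at least `θ` wires are true), the constants and the
input literals.
-/

-- `Summit.PneNP.PneNP.…` duplicates `PneNP` BY DESIGN (single-problem summit, D-0017 layout).
set_option linter.dupNamespace false

noncomputable section

namespace Summit.PneNP.PneNP.Theorems

namespace WCan

open Finset Equiv Literature.Computability.Complexity
open scoped Classical

variable {K r n : ℕ}

/-! ### Values -/

/-- The value of a gate on input `x` (independent of the output wire, `wDAG_val`). -/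
def Vl (K : ℕ) [NeZero n] (x : Fin (r + n) × Fin (r + n) → Bool) (l : Node K r n) : Bool := (wDAG K r n (wA Atom.ff)).val x l

/-- The value of an atom on input `x`. -/
abbrev ev [NeZero n] (x : Fin (r + n) × Fin (r + n) → Bool) (a : Atom K r n) : Bool := Vl K x (.atom a)

/-- The values of any of the entry DAGs are `Vl`. -/
theorem val_wDAG [NeZero n] (out : Wire K r n) (x : Fin (r + n) × Fin (r + n) → Bool) : (wDAG K r n out).val x = Vl K x := rfl

/-! ### Reading the slots of a built record -/

section PrmSlots
variable [NeZero n] (vs : Fin 5 → Fin n) (it : Fin (T n + 1)) (rd s : Fin (n + 1)) (ns : Fin 3 → Fin n) (h1 h2 : Fin (n + 1))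
    (o1 o2 : Option (Fin r)) (us : Finset (Fin n)) (fl : Bool) (b : Fin (NB r n + 1)) (bp : Fin (NBp r n + 1))
/-- slot `vs` -/ @[simp] theorem prm_vs : (prm vs it rd s ns h1 h2 o1 o2 us fl b bp : Prm r n).vs = vs := rfl
/-- slot `it` -/ @[simp] theorem prm_it : (prm vs it rd s ns h1 h2 o1 o2 us fl b bp : Prm r n).it = it := rfl
/-- slot `rd` -/ @[simp] theorem prm_rd : (prm vs it rd s ns h1 h2 o1 o2 us fl b bp : Prm r n).rd = rd := rfl
/-- slot `s` -/ @[simp] theorem prm_s : (prm vs it rd s ns h1 h2 o1 o2 us fl b bp : Prm r n).s = s := rfl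
/-- slot `ns` -/ @[simp] theorem prm_ns : (prm vs it rd s ns h1 h2 o1 o2 us fl b bp : Prm r n).ns = ns := rfl
/-- slot `h1` -/ @[simp] theorem prm_h1 : (prm vs it rd s ns h1 h2 o1 o2 us fl b bp : Prm r n).h1 = h1 := rfl
/-- slot `h2` -/ @[simp] theorem prm_h2 : (prm vs it rd s ns h1 h2 o1 o2 us fl b bp : Prm r n).h2 = h2 := rfl
/-- slot `o1` -/ @[simp] theorem prm_o1 : (prm vs it rd s ns h1 h2 o1 o2 us fl b bp : Prm r n).o1 = o1 := rfl
/-- slot `o2` -/ @[simp] theorem prm_o2 : (prm vs it rd s ns h1 h2 o1 o2 us fl b bp : Prm r n).o2 = o2 := rfl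
/-- slot `us` -/ @[simp] theorem prm_us : (prm vs it rd s ns h1 h2 o1 o2 us fl b bp : Prm r n).us = us := rfl
/-- slot `fl` -/ @[simp] theorem prm_fl : (prm vs it rd s ns h1 h2 o1 o2 us fl b bp : Prm r n).fl = fl := rfl
/-- slot `b` -/ @[simp] theorem prm_b : (prm vs it rd s ns h1 h2 o1 o2 us fl b bp : Prm r n).b = b := rfl
/-- slot `bp` -/ @[simp] theorem prm_bp : (prm vs it rd s ns h1 h2 o1 o2 us fl b bp : Prm r n).bp = bp := rfl
end PrmSlots

/-- slot 0 of `vec1` -/ @[simp] theorem vec1_apply (u : Fin n) (i : Fin 5) : vec1 u i = u := rfl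
/-- slot 0 of `vec2` -/ @[simp] theorem vec2_0 (u v : Fin n) : vec2 u v 0 = u := rfl
/-- slot 1 of `vec2` -/ @[simp] theorem vec2_1 (u v : Fin n) : vec2 u v 1 = v := rfl
/-- slot 2 of `vec2` -/ @[simp] theorem vec2_2 (u v : Fin n) : vec2 u v 2 = v := rfl
/-- slot 0 of `vec3` -/ @[simp] theorem vec3_0 (u v w : Fin n) : vec3 u v w 0 = u := rfl
/-- slot 1 of `vec3` -/ @[simp] theorem vec3_1 (u v w : Fin n) : vec3 u v w 1 = v := rfl
/-- slot 2 of `vec3` -/ @[simp] theorem vec3_2 (u v w : Fin n) : vec3 u v w 2 = w := rfl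
/-- slot 0 of `vec4` -/ @[simp] theorem vec4_0 (u v w y : Fin n) : vec4 u v w y 0 = u := rfl
/-- slot 1 of `vec4` -/ @[simp] theorem vec4_1 (u v w y : Fin n) : vec4 u v w y 1 = v := rfl
/-- slot 2 of `vec4` -/ @[simp] theorem vec4_2 (u v w y : Fin n) : vec4 u v w y 2 = w := rfl
/-- slot 3 of `vec4` -/ @[simp] theorem vec4_3 (u v w y : Fin n) : vec4 u v w y 3 = y := rfl
/-- slot 0 of `nvec1` -/ @[simp] theorem nvec1_apply (p : Fin n) (i : Fin 3) : nvec1 p i = p := rfl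
/-- slot 0 of `nvec2` -/ @[simp] theorem nvec2_0 (p q : Fin n) : nvec2 p q 0 = p := rfl
/-- slot 1 of `nvec2` -/ @[simp] theorem nvec2_1 (p q : Fin n) : nvec2 p q 1 = q := rfl
/-- slot 0 of `nvec3` -/ @[simp] theorem nvec3_0 (p q o : Fin n) : nvec3 p q o 0 = p := rfl
/-- slot 1 of `nvec3` -/ @[simp] theorem nvec3_1 (p q o : Fin n) : nvec3 p q o 1 = q := rfl
/-- slot 2 of `nvec3` -/ @[simp] theorem nvec3_2 (p q o : Fin n) : nvec3 p q o 2 = o := rfl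

variable [NeZero n] (x : Fin (r + n) × Fin (r + n) → Bool)

/-- The defining equation of gate values. -/
theorem Vl_eq (l : Node K r n) : Vl K x l = l.fn.2 fun i => GateDAG.wire x (Vl K x) (l.args i) :=
  (wDAG K r n (wA Atom.ff)).val_eq x l

/-- Reading an atom wire. -/
@[simp] theorem wire_wA (a : Atom K r n) : GateDAG.wire x (Vl K x) (wA a) = ev x a := rfl
/-- Reading a width-8 formula wire. -/
@[simp] theorem wire_w1 (f : N1 K r n) : GateDAG.wire x (Vl K x) (w1 f) = Vl K x (.f1 f) := rfl
/-- Reading a width-4 formula wire. -/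
@[simp] theorem wire_w2 (f : N2 K r n) : GateDAG.wire x (Vl K x) (w2 f) = Vl K x (.f2 f) := rfl
/-- Reading an input wire. -/
@[simp] theorem wire_inl (q : Fin (r + n) × Fin (r + n)) : GateDAG.wire x (Vl K x) (Sum.inl q : Wire K r n) = x q := rfl

/-- A negated atom. -/
@[simp] theorem Vl_natom (a : Atom K r n) : Vl K x (.natom a) = !ev x a := by
  rw [Vl_eq]; rfl

/-- Reading a negated-atom wire. -/
@[simp] theorem wire_wN (a : Atom K r n) : GateDAG.wire x (Vl K x) (wN a) = !ev x a := Vl_natom x a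

/-! ### Literals and formulas -/

/-- A literal HOLDS on `x`: its atom has the literal's polarity as value. -/
def Lit.Holds (x : Fin (r + n) × Fin (r + n) → Bool) (l : Lit K r n) : Prop := ev x l.1 = l.2

/-- A positive literal holds iff its atom is true. -/
@[simp] theorem holds_pos {a : Atom K r n} : Lit.Holds x (pos a) ↔ ev x a = true := Iff.rfl
/-- A negative literal holds iff its atom is false. -/
@[simp] theorem holds_neg {a : Atom K r n} : Lit.Holds x (neg a) ↔ ev x a = false := Iff.rfl

/-- The wire of a literal is true iff the literal holds. -/
theorem wire_lit (l : Lit K r n) : GateDAG.wire x (Vl K x) l.wire = true ↔ Lit.Holds x l := by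
  unfold Lit.wire Lit.Holds
  rcases l with ⟨a, _ | _⟩ <;> simp

/-- A width-8 formula: conjunction or disjunction of its literals. -/
theorem Vl_f1 (f : N1 K r n) : Vl K x (.f1 f) = true ↔
    (if f.isAnd then ∀ i, Lit.Holds x (f.ls i) else ∃ i, Lit.Holds x (f.ls i)) := by
  rw [Vl_eq]
  simp only [Node.fn, fgate, Node.args]
  rcases f with ⟨_ | _, ls⟩ <;> simp [wire_lit]

/-- A width-4 formula: conjunction or disjunction of its operands. -/
theorem Vl_f2 (f : N2 K r n) : Vl K x (.f2 f) = true ↔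
    (if f.isAnd then ∀ i, Vl K x (.f1 (f.xs i)) = true else ∃ i, Vl K x (.f1 (f.xs i)) = true) := by
  rw [Vl_eq]
  simp only [Node.fn, fgate, Node.args]
  rcases f with ⟨_ | _, xs⟩ <;> simp

/-- `tt` is true. -/
@[simp] theorem ev_tt : ev x (Atom.tt : Atom K r n) = true := by
  show Vl K x _ = true; rw [Vl_eq]; simp [Node.fn, Atom.fn, GateFn.and]

/-- `ff` is false. -/
@[simp] theorem ev_ff : ev x (Atom.ff : Atom K r n) = false := by
  show Vl K x _ = false; rw [Vl_eq]; simp [Node.fn, Atom.fn, GateFn.or]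

/-- **Padded conjunction**: true iff every listed literal holds. -/
theorem Vl_n1and (ls : List (Lit K r n)) (hls : ls.length ≤ 8) : Vl K x (.f1 (n1and ls)) = true ↔ ∀ l ∈ ls, Lit.Holds x l := by
  rw [Vl_f1]
  simp only [n1and, ↓reduceIte, List.getD_eq_getElem?_getD]
  constructor
  · intro h l hl
    obtain ⟨i, hi, rfl⟩ := List.mem_iff_getElem.1 hl
    have := h ⟨i, by omega⟩
    simpa [List.getElem?_eq_getElem hi] using this
  · intro h i
    cases hi : ls[(i : ℕ)]? with
    | none => simp
    | some l => simpa using h l (List.mem_of_getElem? hi)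

/-- **Padded disjunction**: true iff some listed literal holds. -/
theorem Vl_n1or (ls : List (Lit K r n)) (hls : ls.length ≤ 8) : Vl K x (.f1 (n1or ls)) = true ↔ ∃ l ∈ ls, Lit.Holds x l := by
  rw [Vl_f1]
  simp only [n1or, Bool.false_eq_true, ↓reduceIte, List.getD_eq_getElem?_getD]
  constructor
  · rintro ⟨i, hi⟩
    cases h : ls[(i : ℕ)]? with
    | none => simp [h, Lit.Holds] at hi
    | some l => exact ⟨l, List.mem_of_getElem? h, by simpa [h] using hi⟩
  · rintro ⟨l, hl, h⟩
    obtain ⟨i, hi, rfl⟩ := List.mem_iff_getElem.1 hl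
    exact ⟨⟨i, by omega⟩, by simpa [List.getElem?_eq_getElem hi] using h⟩

/-- A single literal as a formula. -/
theorem Vl_litN1 (l : Lit K r n) : Vl K x (.f1 (litN1 l)) = true ↔ Lit.Holds x l := by
  rw [litN1, Vl_n1and x _ (by simp)]; simp

/-- **Padded width-4 conjunction**. -/
theorem Vl_n2and (xs : List (N1 K r n)) (hxs : xs.length ≤ 4) :
    Vl K x (.f2 (n2and xs)) = true ↔ ∀ f ∈ xs, Vl K x (.f1 f) = true := by
  rw [Vl_f2]
  simp only [n2and, ↓reduceIte, List.getD_eq_getElem?_getD]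
  constructor
  · intro h f hf
    obtain ⟨i, hi, rfl⟩ := List.mem_iff_getElem.1 hf
    have := h ⟨i, by omega⟩
    simpa [List.getElem?_eq_getElem hi] using this
  · intro h i
    cases hi : xs[(i : ℕ)]? with
    | none => simp [Vl_n1and x [] (by simp)]
    | some f => simpa using h f (List.mem_of_getElem? hi)

/-- **Padded width-4 disjunction**. -/
theorem Vl_n2or (xs : List (N1 K r n)) (hxs : xs.length ≤ 4) :
    Vl K x (.f2 (n2or xs)) = true ↔ ∃ f ∈ xs, Vl K x (.f1 f) = true := by
  rw [Vl_f2]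
  simp only [n2or, Bool.false_eq_true, ↓reduceIte, List.getD_eq_getElem?_getD]
  constructor
  · rintro ⟨i, hi⟩
    cases h : xs[(i : ℕ)]? with
    | none => rw [h] at hi; simp [Vl_n1or x [] (by simp)] at hi
    | some f => exact ⟨f, List.mem_of_getElem? h, by simpa [h] using hi⟩
  · rintro ⟨f, hf, h⟩
    obtain ⟨i, hi, rfl⟩ := List.mem_iff_getElem.1 hf
    exact ⟨⟨i, by omega⟩, by simpa [List.getElem?_eq_getElem hi] using h⟩

/-- `iffF a b` computes `a ↔ b`. -/
theorem Vl_iffF (a b : Atom K r n) : Vl K x (.f2 (iffF a b)) = true ↔ (ev x a = true ↔ ev x b = true) := by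
  rw [iffF, Vl_n2or x _ (by simp)]
  simp only [List.mem_cons, List.not_mem_nil, or_false, exists_eq_or_imp, exists_eq_left, Vl_n1and x _ (by simp : [pos a, pos b].length ≤ 8),
    Vl_n1and x _ (by simp : [neg a, neg b].length ≤ 8), forall_eq_or_imp, forall_eq, holds_pos, holds_neg]
  cases ev x a <;> cases ev x b <;> simp

/-! ### Counters -/

/-- The number of ones of a tuple of truth values. -/
theorem numOnes_eq_card {N : ℕ} (v : Fin N → Bool) : GateFn.numOnes v = (univ.filter fun i => v i = true).card := rfl

/-- **The padded majority counter**: with `θ ≤ N`, `MAJ_{2N}` over `cnt N θ ws` fires iff at least `θ` of the wires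
`ws` are true. -/
theorem maj_cnt_iff {N θ : ℕ} (hθ : θ ≤ N) (ws : Fin N → Wire K r n) :
    (GateFn.maj (N + N)).2 (fun i => GateDAG.wire x (Vl K x) (cnt N θ ws i)) = true ↔
      θ ≤ (univ.filter fun i => GateDAG.wire x (Vl K x) (ws i) = true).card := by
  have happ : (fun i : Fin (N + N) => GateDAG.wire x (Vl K x) (cnt N θ ws i)) =
      Fin.append (fun i => GateDAG.wire x (Vl K x) (ws i)) (fun k : Fin N => decide ((k : ℕ) + θ < N)) := by
    funext i
    unfold cnt
    induction i using Fin.addCases with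
    | left i => simp only [Fin.append_left]
    | right j =>
      simp only [Fin.append_right]
      split_ifs with h <;> simp [h]
  show decide (N + N ≤ 2 * GateFn.numOnes (fun i : Fin (N + N) => GateDAG.wire x (Vl K x) (cnt N θ ws i))) = true ↔ _
  rw [happ, decide_eq_true_iff, Literature.Computability.AlgebraicComplexity.LabelledArithCircuit.numOnes_append, numOnes_eq_card, numOnes_eq_card]
  have hpad : (univ.filter fun k : Fin N => decide ((k : ℕ) + θ < N) = true).card = N - θ := by
    have : (univ.filter fun k : Fin N => decide ((k : ℕ) + θ < N) = true) = univ.filter fun k : Fin N => (k : ℕ) + θ < N := by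
      ext k; simp
    rw [this]
    have heq : (univ.filter fun k : Fin N => (k : ℕ) + θ < N) = univ.image (Fin.castLE (Nat.sub_le N θ) : Fin (N - θ) → Fin N) := by
      ext k
      simp only [mem_filter, mem_univ, true_and, mem_image]
      constructor
      · intro hk; exact ⟨⟨k, by omega⟩, Fin.ext rfl⟩
      · rintro ⟨k', rfl⟩; have := k'.2; simp only [Fin.val_castLE]; omega
    rw [heq, card_image_of_injective _ (Fin.castLE_injective _), card_univ, Fintype.card_fin]
  rw [hpad]
  have hle : (univ.filter fun i => GateDAG.wire x (Vl K x) (ws i) = true).card ≤ N :=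
    (card_filter_le _ _).trans_eq (by simp)
  omega

/-! ### Inputs -/

/-- The WINDOW GRAPH of the input: vertices `Fin n`, `u ~ v` iff `u ≠ v` and `x(wv u, wv v) ∨ x(wv v, wv u)`. -/
def G (x : Fin (r + n) × Fin (r + n) → Bool) : SimpleGraph (Fin n) :=
  SimpleGraph.fromRel fun u v => x (wv r u, wv r v) = true

omit [NeZero n] in
/-- Adjacency in the window graph. -/
theorem G_adj {u v : Fin n} : (G x).Adj u v ↔ u ≠ v ∧ (x (wv r u, wv r v) = true ∨ x (wv r v, wv r u) = true) := by
  simp [G, SimpleGraph.fromRel_adj]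

/-- The OUTSIDE BIT: window vertex `v` against outside index `o`, symmetrised. -/
def xo (x : Fin (r + n) × Fin (r + n) → Bool) (v : Fin n) (o : Fin r) : Bool := x (wv r v, ov n o) || x (ov n o, wv r v)

/-- `exV u v` reads the symmetrised window entry. -/
theorem ev_aExV (u v : Fin n) : ev x (aExV (K := K) u v) = true ↔ (x (wv r u, wv r v) = true ∨ x (wv r v, wv r u) = true) := by
  show Vl K x _ = true ↔ _
  rw [Vl_eq]
  show (GateFn.or 2).2 (fun i => GateDAG.wire x (Vl K x) (SKind.args (K := K) .exV (prm (vec2 u v)) i)) = true ↔ _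
  simp [GateFn.or, SKind.args, Fin.exists_fin_two]

/-- `exO v o` reads the symmetrised outside bit. -/
theorem ev_aExO (v : Fin n) (o : Fin r) : ev x (aExO (K := K) v o) = true ↔ xo x v o = true := by
  show Vl K x _ = true ↔ _
  rw [Vl_eq]
  show (GateFn.or 2).2 (fun i => GateDAG.wire x (Vl K x) (SKind.args (K := K) .exO (prm (vec1 v) (o1 := some o)) i)) = true ↔ _
  simp [GateFn.or, SKind.args, Fin.exists_fin_two, xo]

/-- `oo o o'` reads the symmetrised outside–outside entry. -/
theorem ev_oo (o o' : Fin r) : ev x (Atom.oo (K := K) (n := n) o o') = true ↔ (x (ov n o, ov n o') = true ∨ x (ov n o', ov n o) = true) := by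
  show Vl K x _ = true ↔ _
  rw [Vl_eq]
  show (GateFn.or 2).2 (fun i => GateDAG.wire x (Vl K x) (Atom.args (Atom.oo (K := K) (n := n) o o') i)) = true ↔ _
  simp [GateFn.or, Atom.args, Fin.exists_fin_two]

/-- The adjacency literal holds iff the vertices are adjacent in the window graph. -/
theorem holds_adjLit (u v : Fin n) : Lit.Holds x (adjLit (K := K) (r := r) u v) ↔ (G x).Adj u v := by
  unfold adjLit
  by_cases h : u = v
  · subst h; simp [Lit.Holds]
  · rw [if_neg h, G_adj, holds_pos, show Atom.sh SKind.exV (prm (vec2 u v)) = aExV (K := K) (r := r) u v from rfl, ev_aExV]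
    simp [h]

/-- The negated adjacency literal holds iff the vertices are not adjacent. -/
theorem holds_nadjLit (u v : Fin n) : Lit.Holds x (nadjLit (K := K) (r := r) u v) ↔ ¬ (G x).Adj u v := by
  unfold nadjLit
  by_cases h : u = v
  · subst h; simp [Lit.Holds]
  · rw [if_neg h, G_adj, holds_neg, show Atom.sh SKind.exV (prm (vec2 u v)) = aExV (K := K) (r := r) u v from rfl]
    have := ev_aExV (K := K) x u v
    constructor
    · intro h1 ⟨_, h2⟩; rw [← this] at h2; rw [h1] at h2; exact Bool.false_ne_true h2
    · intro h1
      cases h2 : ev x (aExV (K := K) u v)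
      · rfl
      · exact absurd ⟨h, this.1 h2⟩ h1

end WCan

end Summit.PneNP.PneNP.Theorems

end
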